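import Literature.MathematicalPhysics.QuantumFieldTheory.Balaban1983to89.B10
import Literature.MathematicalPhysics.QuantumFieldTheory.Balaban1983to89.UnitaryModel

/-!
# Bałaban CMP 102 (1985) 255–275, AS-PRINTED SPINE — `Setting`: the Introduction, pp. 255–257
# (displays (1)–(6) and the objects Theorem 1 speaks about), over CONCRETE d = 3 carriers

Source: T. Bałaban, *Ultraviolet stability of three-dimensional lattice pure gauge field theories*, Commun. Math.
Phys. **102** (1985) 255–275, doi:10.1007/bf01229380 [Balaban1985UV3] (= [B10] of the cells `pub-balaban` /
`pub-balaban3d`; held as `paper:balaban1985-cmp102-uv-stability-3d`; PDF page = journal page − 254).  Every quotation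
below was read on the page RENDERS `run/shared/lean/pub/pub-balaban/b2b-balaban-ref1/pages/1985-cmp102-uv-stability-3d/
…-p002-x2.png`, `…-p003-x2.png` (the displays are garbled in the ABBYY text layer); the locator `p.256 = PDF 2 Lnn` gives
the journal page, the PDF page and the LINE NUMBER OF THE TEXT-LAYER file `p0002.txt` as materialised by `lit read` (running
head = L1; displays count as the lines the layer gives them), so that the referee can `sed -n` it.  Inputs the Introduction cites: [4] = T. Bałaban, CMP **98** (1985) 17–51 [Balaban1985Averaging] (the
renormalization transformation (10) p. 19 and the averaging operation (15) p. 19, renders `…/1985-cmp98-averaging/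
…-p002-x2.png`, `…-p003-x2.png`); [7] = T. Bałaban, CMP **102** (1985) 277–309 [Balaban1985Variational] (the minimal
configurations `U_k`, Thm 1 p. 279 and (2)–(8) pp. 278–279, render `…/1985-cmp102-variational-background/…-p002-x2.png`).

HONEST FRAMING (lane pub-balaban3d PLAN.md §0, binding).  This file TYPES the printed setting; it asserts NOTHING of the
paper.  Every object the Introduction names is either DEFINED here over the tree's lattice-gauge vocabulary
(`…Balaban1983to89.Setup`: tori `Site P j`, bond variables `GaugeField P j G`, plaquette variables `plaqHol`, Wilson
action `wilsonAction`, product Haar measure `fieldMeasure`, averaging operations `Averaging`, renormalization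
transformations `RTOpI`/`IsRT`, small-field predicates `PlaqSmall`/`chiSmall`, minimizers `IsBackground`) or enters as a
BINDER (a field of `RunObjects`) whose docstring quotes the sentence of print that introduces it and the cited paper that
constructs it.  Theorem 1 itself, the bounds (5), the audit readings and the recorded negative knowledge are the 4D cell's
declarations `…Balaban1983to89.B10.{RunData, Bounds5, Bounds5At, Thm1Printed, Thm1PrintedCompact}` RE-USED BY NAME through
the map `RunObjects.toRunData` (nothing of `B10.lean` is re-typed); the literal reading `B10.Thm1Printed` is KERNEL-FALSE
on the paper's own leaf system (`…B10DagLeaf.not_thm1Printed_of_leafSystems`, cell pub-balaban GAPS G-B10-01: the term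
`d(𝔤) log g_k |T₁^{(k)*}|` of (62) p. 271), the compact-coupling-window reading `B10.Thm1PrintedCompact` is the one
certified from the printed leaves (`…B10Assembly.thm1Compact_and_thm2_of_leafSystem`).  Both readings are instantiated in
`…Balaban1985CMP102.Theorems` and the divergence is carried by name, not re-argued.

WHAT IS TYPED HERE (journal page = PDF page + 254):
* §1 `GroupModel` — the printed hypotheses on the gauge group: Thm 1 p. 257 «a semi-simple compact group Lie G»; [4] p. 18
  «with values in a Lie subgroup G of a unitary group U(N)»; the interface functions `dist1 = |· − 1|` ([4] (19) p. 21)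
  and `reTr = Re tr` of `Setup.GaugeGroup` pinned to the unitary matrix model of `…UnitaryModel`.
* §2 `Scales` — p. 256: the torus `T_ε`, `L`, the number of steps `K` with «L^K ε = ε₀» (L16–18), the coupling `g` with
  «g₀² = g²ε^{4−d} = g²ε (d = 3)» ((1), L4), «g_k = g(L^kε)^{1/2}» and «|T₁^{(k)}| = Σ_{y∈T₁^{(k)}} 1 = Σ_{x∈T_η} η³ =
  (L^kε)^{−3}|T_ε|» (display after (5), L37–39), «|T_ε| = Σ_{x∈T_ε} ε³» ((3), L22–23), «η = L^{−k}».
* §3 `RunObjects` — the objects of (1)–(6) for one lattice approximation: `ρ₀` by (1), `ρ_{k+1} = Tρ_k` (2) with `T` the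
  transformation (10) of [4] (binder, over the binder «averaging operation» `Ū` of [4]), the characteristic function `χ`
  of (4), `A^η(U_k(U))` of (5) with `U_k` «the minimal configuration constructed in [7]» (binder), `Z^ε` of (6); the
  as-printed propositions `Bounds3` (3), `Eq6` (6), `IsMinimalConfig` ([7] as used on p. 256 L35–36); the bridge
  `toRunData : RunObjects → B10.RunData`.
* Theorem 1 itself (p. 257 L4–7; literal and compact readings, the uniformity clause of (3), the negative edge) is the
  sibling `…Balaban1985CMP102.Theorems`, stated about a CONSTRUCTION of these run objects for every group as printed and every
  lattice approximation; print's construction ((10)+(15) of [4], Thm 1 of [7], `E` by (62)/(64) pp. 271/273, `ε₁` by (7)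
  p. 257) is to be BUILT by the lane's carrier seat (PLAN §3.1 p1), not typed here.
WHAT IS NOT HERE: Sect. A–D ((7)–(71), Thm 2: `…Balaban1985CMP102.SectA/SectB` and typer-2's `SectC/SectD/Binders`); any
construction of `T`, `Ū`, `U_k`, `E`; any theorem with mathematical content (one `rfl`-level unfolding lemma only).
CARRIER CONVENTIONS (cell pub-balaban NOTATION.md / `Setup` docstrings): lattice level `j = 0` of `Setup` is the FINEST
torus `T_ε = T_η` (print's `T`, `T_η`), level `j = k` is print's `T^{(k)} = T₁^{(k)}` («It is convenient to assume that all
the lattices T^{(k)} are unit lattices», p. 256 L12–13); `Setup`'s tori have `2·L^{m+K−j}` sites per direction (cell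
DIVERGENCE F2: print's torus `T` of [4] (5) p. 18 has arbitrary periods; here the physical period is `2L^m ε₀`), blocks
are centred (F3); `reTr` is the normalized trace `Re Tr/N` of `…UnitaryModel` (F11; pp. 255–257 print «Re tr» without
defining `tr`); d = 3 is the FIELD `Params.d = 3` of `Scales.P`.
-/

namespace Literature.MathematicalPhysics.QuantumFieldTheory.Balaban1985CMP102.Setting

open Literature.MathematicalPhysics.QuantumFieldTheory.Balaban1983to89
open _root_.MeasureTheory

-- Mathlib idiom (`Mathlib.Algebra.Lie.OfAssociative`, as in the tree's `Literature.Algebra.Lie.CompactKillingForm`): the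
-- commutator bracket on the associative ring `M_N(ℂ)` is the NON-instance `LieRing.ofAssociativeRing`, enabled file-locally;
-- it overrides nothing (there is no global `LieRing (Matrix n n ℂ)`), so `GroupModel.lie` has the same type as
-- `CompactKillingForm.unitaryLie`/`su`.
attribute [local instance 100] LieRing.ofAssociativeRing

/-! ## §1 The gauge group as printed (Thm 1 p. 257 L5; [4] p. 18 L22–23, (19) p. 21) -/

/-- The PRINTED HYPOTHESES ON THE GAUGE GROUP, as data over the tree's interface `Setup.GaugeGroup G` (+ a measurable
structure): [Balaban1985UV3] Thm 1 p. 257 = PDF 3 L4–5 «… pure Yang-Mills theory with a semi-simple compact group Lie G»;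
p. 256 = PDF 2 L20–21 «field configurations have values in the compact Lie group G»; [4] = [Balaban1985Averaging] p. 18
L22–23 «Gauge field configurations U are defined on a set of bonds in Ω, and with values in a Lie subgroup G of a unitary
group U(N)».  Fields: a faithful unitary matrix realisation `ρ : G →* M_N(ℂ)`, `ρ(G) ⊂ U(N)`, with CLOSED range (a
closed subgroup of `U(N)` is compact, and is an embedded Lie subgroup by Cartan's closed-subgroup theorem — tree
`…Balaban1983to89.LogChartClosedSubgroup`, [Hall2015] Thm 3.42/Cor 3.45); the interface functions of `GaugeGroup` ARE the
model's: `dist1 g = ‖ρ g − 1‖_{op}` ([4] (19) p. 21, `UnitaryModel.opDist1`) and `reTr g = Re Tr ρ(g)/N`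
(`UnitaryModel.nReTr`, cell DIVERGENCE F11); the measurable structure of `G` is the Borel structure pulled back along
`ρ` (so that `Setup.HaarData`, a bi-invariant probability measure, is the normalized Haar measure of the compact group,
[4] (10) p. 19 «dU is a product of Haar measures of the group G»); the Lie algebra `𝔤 = {X : e^{tX} ∈ G ∀ t ∈ ℝ}`
([Hall2015] Def. 3.18) as a real Lie subalgebra of `M_N(ℂ)`, and «semi-simple» = Mathlib's `LieAlgebra.IsSemisimple ℝ 𝔤`.
CONVENTION (lane ruling R-SEMI, kernel fact found by the lane's p3): Mathlib's `LieAlgebra.IsSemisimple ℝ 𝔤` HOLDS for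
`𝔤 = 0`, so a FINITE (closed, zero-dimensional) subgroup of `U(N)` is a «group as printed» under this typing; print's (18)
p. 260 (the Lebesgue measure `dA′` on `𝔤`, `σ₀ = σ(0)`) and (22) p. 261 («d(𝔤) denotes a dimension of the Lie algebra
𝔤») presuppose `dim 𝔤 ≥ 1`, which the lane's negative-edge theorems carry as an EXPLICIT hypothesis (`1 ≤ finrank ℝ 𝔤`);
Theorem 1 / Theorem 2 are unaffected (every analytic input is a hypothesis).  p. 257 L8–10: «The above theorem can be generalized to a much wider class of compact Lie groups, as it will be clear from
the proof. We have restricted ourselves to semi-simple groups because then the proof is particularly simple.» (context,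
not typed). [cite: Balaban1985UV3, Thm 1 p.257] -/
structure GroupModel (G : Type) [Balaban1983to89.GaugeGroup G] [MeasurableSpace G] where
  /-- the size `N` of the unitary group `U(N) ⊃ G` ([4] p. 18 L23) -/
  N : ℕ
  /-- `N ≥ 1` (so that `Re Tr/N` and `U(N)` are the intended objects) -/
  N_pos : 0 < N
  /-- the matrix realisation `G → M_N(ℂ)` (a group homomorphism) -/
  ρ : G →* Matrix (Fin N) (Fin N) ℂ
  /-- «a Lie subgroup G of a unitary group U(N)» ([4] p. 18 L22–23): values in `U(N)` -/
  mem_unitary : ∀ g, ρ g ∈ Matrix.unitaryGroup (Fin N) ℂ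
  /-- the realisation is faithful (`G ⊂ U(N)`) -/
  injective : Function.Injective ρ
  /-- «compact» (p. 256 L20–21, Thm 1 p. 257 L5): the image is closed in `M_N(ℂ)`, hence a compact (and, by Cartan's
  theorem, Lie) subgroup of `U(N)` -/
  isClosed_range : IsClosed (Set.range ρ)
  /-- `|· − 1|` of (4) p. 256 is the operator-norm distance of the model ([4] (19) p. 21) -/
  dist1_eq : ∀ g, Balaban1983to89.dist1 g = Balaban1983to89.UnitaryModel.opDist1 (ρ g)
  /-- «Re tr» of (1), (5) p. 256 is the (normalized, cell DIVERGENCE F11) real trace of the model -/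
  reTr_eq : ∀ g, Balaban1983to89.reTr g = Balaban1983to89.UnitaryModel.nReTr (ρ g)
  /-- the measurable structure of `G` is the Borel structure of `M_N(ℂ)` pulled back along `ρ` -/
  measurableSpace_eq :
    (inferInstance : MeasurableSpace G) = MeasurableSpace.comap ρ (borel (Matrix (Fin N) (Fin N) ℂ))
  /-- the Lie algebra `𝔤` of `G` as a real Lie subalgebra of `M_N(ℂ)` -/
  lie : LieSubalgebra ℝ (Matrix (Fin N) (Fin N) ℂ)
  /-- `𝔤 = {X : exp(tX) ∈ G for all real t}` ([Hall2015] Def. 3.18) -/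
  mem_lie_iff : ∀ X : Matrix (Fin N) (Fin N) ℂ, X ∈ lie ↔ ∀ t : ℝ, NormedSpace.exp ((t : ℂ) • X) ∈ Set.range ρ
  /-- «semi-simple» (Thm 1 p. 257 L5); NB Mathlib's notion holds for `lie = ⊥` too (R-SEMI convention above) -/
  semisimple : LieAlgebra.IsSemisimple ℝ lie

/-! ## §2 The lattices and the numerical data of one lattice approximation (p. 256 = PDF 2) -/

/-- The d = 3 lattice parameters of `Setup` for block size `L`, volume exponent `m` and `K` renormalization steps:
`Params.d = 3` («three-dimensional», Thm 1 p. 257 L4; «d = 3», (1) p. 256 L4).  Level `j = 0` is the torus `T_ε`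
(`2L^{m+K}` sites per direction), level `j = K` the lattice `T₁^{(K)}` on which the construction terminates (p. 256
L15–18). [cite: Balaban1985UV3, (1)–(2) p.256] -/
def params3 (L : ℕ) (hL : Odd L ∧ 1 < L) (m K : ℕ) : Balaban1983to89.Params :=
  ⟨3, L, m, K, by norm_num, hL⟩

/-- ONE LATTICE APPROXIMATION, numerically (p. 256 = PDF 2): the block size `L` of the renormalization transformations of
[4] (a parameter of the type, fixed across the family Theorem 1 quantifies over; `Odd L ∧ 1 < L` as `Setup.Params`
demands), the volume exponent `m` (the torus `T₁^{(K)}` has `2L^m` sites per direction, cell DIVERGENCE F2), the number of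
steps `K` and the lattice spacing `ε` with L16–18 «We terminate constructions of the densities ρ_k when we reach the unit
lattice, or more exactly when L^kε = ε₀, where ε₀ is a positive constant depending on the coupling constant g only. Let
us denote by K the index satisfying this equality, i.e. L^Kε = ε₀. Obviously K depends on ε and ε₀.» (fields `ε`, `ε₀`,
`hK`), the coupling constant `g` of (1) L4 «g₀² = g²ε^{4−d} = g²ε (d = 3)», and the standing smallness of the terminal
coupling `g²ε₀ ≤ 1` (field `gK_le_one`, the cell's normalisation of «sufficiently small», see its docstring). [cite: Balaban1985UV3, (1)–(2) p.256] -/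
structure Scales (L : ℕ) where
  /-- `L` odd and `> 1` (`Setup.Params.hL`) -/
  hL : Odd L ∧ 1 < L
  /-- volume exponent: `T₁^{(K)}` has `2L^m` sites per direction -/
  m : ℕ
  /-- the number `K` of renormalization steps, «L^Kε = ε₀» (p. 256 L18) -/
  K : ℕ
  /-- the lattice spacing `ε` of `T_ε` (p. 256 L14) -/
  ε : ℝ
  /-- `ε > 0` -/
  ε_pos : 0 < ε
  /-- «ε₀ is a positive constant depending on the coupling constant g only» (p. 256 L16–17) -/
  ε₀ : ℝ
  /-- «L^Kε = ε₀» (p. 256 L18) -/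
  hK : (L : ℝ) ^ K * ε = ε₀
  /-- the coupling constant `g` of (1) (p. 256 L4) -/
  g : ℝ
  /-- `g > 0` -/
  g_pos : 0 < g
  /-- «ε₀ is a positive constant depending on the coupling constant g only» (p. 256 L16–17) together with «For g₀
  sufficiently small» (p. 259 L1), «for g_{k−1} sufficiently small» (p. 267 L7–8), «g_k sufficiently small» (p. 268):
  the terminal coupling `g_K = gε₀^{1/2}` — the largest along the flow, `g_k = g(L^kε)^{1/2} ≤ g_K` — is below the
  smallness threshold of the construction, NORMALISED TO 1 (`g_K² = g²ε₀ ≤ 1`) as in the 4D cell's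
  `B10Assembly.LeafSystem.g_le_one` («g_k ≤ 1, k ≤ K»; the leaves' constants absorb the printed threshold).  A CONVENTION
  of the cell, recorded as such (lane STATUS P3-F1); print fixes no number. -/
  gK_le_one : g ^ 2 * ε₀ ≤ 1

namespace Scales

variable {L : ℕ} (S : Scales L)

/-- The `Setup` lattice parameters of this approximation (`d = 3`). [cite: Balaban1985UV3, (1)–(2) p.256] -/
def P : Balaban1983to89.Params := params3 L S.hL S.m S.K

/-- (1) p. 256 = PDF 2 L4: «g₀² = g²ε^{4−d} = g²ε (d = 3)». [cite: Balaban1985UV3, (1) p.256] -/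
def g0sq : ℝ := S.g ^ 2 * S.ε

/-- p. 256 = PDF 2 L39 (display after (5)): «g_k = g(L^kε)^{1/2}» — the 4D cell's `B10.gRun` BY NAME (so `g₀ = gε^{1/2}`,
`g₀² = g²ε` = `g0sq`). [cite: Balaban1985UV3, (5) p.256] -/
noncomputable def gk (k : ℕ) : ℝ := Balaban1983to89.B10.gRun S.g (L : ℝ) S.ε k

/-- (3) p. 256 = PDF 2 L22–23: «|T_ε| = Σ_{x∈T_ε} ε³» (the volume of the torus), literally as the sum over the sites of
the finest lattice. [cite: Balaban1985UV3, (3) p.256] -/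
noncomputable def volT : ℝ := ∑ _x : Balaban1983to89.Site S.P 0, S.ε ^ 3

/-- p. 256 = PDF 2 L39 (display after (5)): «|T₁^{(k)}| = Σ_{y∈T₁^{(k)}} 1», the number of sites of `T^{(k)}`, literally
(the FIRST printed expression; see `sites` for the one used in (5)). [cite: Balaban1985UV3, (5) p.256] -/
noncomputable def sitesOne (k : ℕ) : ℝ := ∑ _y : Balaban1983to89.Site S.P k, (1 : ℝ)

/-- p. 256 = PDF 2 L39 (display after (5)): «|T₁^{(k)}| = Σ_{y∈T₁^{(k)}} 1 = Σ_{x∈T_η} η³ = (L^kε)^{−3}|T_ε|» — `|T₁^{(k)}|` as the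
LAST printed expression `(L^kε)^{−3}|T_ε|`, i.e. the 4D cell's `B10.sitesRun L ε |T_ε| k` BY NAME (so that
`B10Assembly.LeafSystem.sites_eq` holds by `rfl` for these carriers).  The printed equality with `sitesOne k` (the site
count of `Setup`'s torus `T^{(k)}`, `(2L^{m+K−k})³` sites) is an identity for `k ≤ K` to be proved by the carrier seat
(PLAN §3.1 p3), not asserted here. [cite: Balaban1985UV3, (5) p.256] -/
noncomputable def sites (k : ℕ) : ℝ := Balaban1983to89.B10.sitesRun (L : ℝ) S.ε S.volT k

/-- p. 256 = PDF 2 L37: «η = L^{−k}» — `Setup.Params.eta` BY NAME. [cite: Balaban1985UV3, (5) p.256] -/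
noncomputable def eta (k : ℕ) : ℝ := S.P.eta k

/-- p. 256 = PDF 2 L37 (display after (5)): «A^η(U_k(U)) = Σ_{p⊂T_η} η^{−1}[1 − Re tr U_k(U, ∂p)],  η = L^{−k}» — the
η-scaled d = 3 Wilson action `A^η(U) = Σ_{p⊂T_η} η^{−1}[1 − Re tr U(∂p)]` of a configuration `U` on the finest lattice
`T_η` (`Setup.wilsonAction` with the weight `η^{d−4} = η^{−1}`). [cite: Balaban1985UV3, (5) p.256] -/
noncomputable def actionEta {G : Type} [Balaban1983to89.GaugeGroup G] (k : ℕ)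
    (U : Balaban1983to89.GaugeField S.P 0 G) : ℝ :=
  Balaban1983to89.wilsonAction (S.eta k)⁻¹ U

end Scales

/-! ## §3 The objects of (1)–(6) for one lattice approximation (pp. 256–257 = PDF 2–3) -/

/-- THE RUN OBJECTS of one lattice approximation `S` with gauge group `G`: the data the displays (1)–(6) and Theorem 1
are ABOUT, as binders.  `E` — (1) p. 256 L5–9 «E is a constant including normalization terms and vacuum energy
renormalization counterterms. This constant can be defined perturbatively by a finite order expansion of the integral
∫dU (gauge fixing term) exp[−(1/g₀²)A(U)] with respect to g, but we prefer to give an inductive definition during the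
proof.» (that definition is (36) p. 265 L20 «E₁ = E − E^{(0)}», (62) p. 271 L18 «E_{k+1} = E_k − E^{(k)}», (64) p. 273
«E_k = Σ_{j=k}^{K−1} E^{(j)}»: `E = E₀ = Σ_{j<K} E^{(j)}` — the identification `SectB.TowerObjects.E_eq`, lane ruling R-E).  `ε₁` — (4) p. 256 L27 «where ε₁ is a
sufficiently small positive constant, which will be chosen later» ((7) p. 257 L33–35: «we take ε₁ = g₀p(g₀), where
p(g) = b₀(1 + log g^{−1})^{p₀}, p₀ > 2 and b₀ is a sufficiently large absolute constant», `B10.pFun`; the step-k threshold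
is Sect. D's), indexed by the step.  `av`, `T` — (2) p. 256 L9–11 «To the density ρ₀ we apply successively the
renormalization transformations T described in [1, 4]. This yields a sequence of densities ρ_k defined inductively by
ρ_{k+1} = Tρ_k. (2)»; [4] (10) p. 19 «ρ′(V) = ∫dU δ(VŪ^{−1}) ρ(U), (10) where … U is a gauge field configuration on the
lattice Ω^{(j)}, V is a configuration on the lattice Ω^{(j+1)} and dU is a product of Haar measures of the group G. The
most important part of the above definition is an averaging operation Ū» — `av j` is that operation `U ↦ Ū` on level `j`
(tree `Setup.Averaging`: gauge covariance = [4] (11) p. 19, locality) and `T j` the transformation (10) in the tree's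
push-forward reading on integrable densities (`Setup.RTOpI`, `Setup.IsRT`, cell DIVERGENCE F7/F17); print's SPECIFIC
average is [4] (15) p. 19 «Ū_c = exp[i Σ_{x∈B(c₋)} L^{−d} (1/i) log U(Γ_{c,x})U(c)^{−1}] U(c)», which needs the matrix
model (`log`, `exp`) and is NOT typed at this level (binder; the carrier seat builds it, PLAN §3.3 D-1).  `reg`, `Uk` —
(5) p. 256 L35–36 «where U_k(U) is the minimal configuration constructed in [7] and determined by the configuration U on
T₁^{(k)}, and satisfying (4)»: `Uk k V` is that configuration on `T_η` and `reg k` the space of regular configurations of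
[7] ((2), (6), (8) pp. 278–279 with all `Ω_j = T`) in which it is minimal (`IsMinimalConfig` below; existence, uniqueness
up to gauge and regularity are [7] Thm 1 p. 279 — a binder of the lane, never asserted here).  `ineq41_47` — the abstract
slot «ρ_k satisfies the inequalities (41), (47)» of `B10.RunData` (Sect. B pp. 265–267, Theorem 2's conclusion; pinned to
the typed displays `B10.Ineq41`/`B10.Ineq47` at the `TowerRun` level, `B10.SpecOK`); neither (5) nor Theorem 1 reads it. [cite: Balaban1985UV3, (1)–(6) pp.256–257] -/
structure RunObjects {L : ℕ} (S : Scales L) (G : Type) [Balaban1983to89.GaugeGroup G] [MeasurableSpace G]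
    [Balaban1983to89.HaarData G] where
  /-- `E` of (1), p. 256 L5–9 «a constant including normalization terms and vacuum energy renormalization
  counterterms … we prefer to give an inductive definition during the proof» (= `E₀ = Σ_{j<K} E^{(j)}` by (36), (62),
  (64): `SectB.TowerObjects.E_eq`) -/
  E : ℝ
  /-- `ε₁` of (4), per step -/
  ε₁ : ℕ → ℝ
  /-- the averaging operation `U ↦ Ū` of [4] from level `j` to level `j+1` -/
  av : ∀ j, Balaban1983to89.Averaging S.P j G
  /-- the renormalization transformation `T` of (2) = (10) of [4] over `av j` -/
  T : ∀ j, Balaban1983to89.RTOpI S.P j G (av j)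
  /-- the space of regular configurations of [7] at step `k` (on `T_η`, level 0) -/
  reg : ℕ → Set (Balaban1983to89.GaugeField S.P 0 G)
  /-- `U_k(U)`: the minimal configuration of [7] determined by `U` on `T₁^{(k)}` -/
  Uk : (k : ℕ) → Balaban1983to89.GaugeField S.P k G → Balaban1983to89.GaugeField S.P 0 G
  /-- «ρ_k satisfies (41), (47)» (the `B10.RunData.Ineq41_47` slot) -/
  ineq41_47 : ℕ → Prop

namespace RunObjects

variable {L : ℕ} {S : Scales L} {G : Type} [Balaban1983to89.GaugeGroup G] [MeasurableSpace G]
  [Balaban1983to89.HaarData G] (R : RunObjects S G)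

/-- **(1)** p. 256 = PDF 2 L2–4: «We start with the action density  ρ₀(U) = exp[−(1/g₀²)A(U) − E],  (1)  where U is a
gauge field configuration on the torus T, g₀² = g²ε^{4−d} = g²ε (d = 3), A(U) is the Wilson action».  `A(U) = Σ_p
[1 − Re tr U(∂p)]` is `Setup.wilsonAction4` (weight 1: all lattices are unit lattices, p. 256 L12–13; the name's «4» is the
4D cell's, the definition is d-free); this is the shape `Step.DensityRG.IsWilsonStart g₀ E` of the 4D cell with `g₀² =
S.g0sq`. [cite: Balaban1985UV3, (1) p.256] -/
noncomputable def rho0 : Balaban1983to89.Density S.P 0 G :=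
  fun U => Real.exp (-(1 / S.g0sq) * Balaban1983to89.wilsonAction4 U - R.E)

/-- **(2)** p. 256 = PDF 2 L11: «ρ_{k+1} = Tρ_k. (2)  The density ρ_k(U) is a function of configurations U defined on the
lattice T^{(k)}», with `ρ₀` = (1) and `T` = the binder `R.T k` (the transformation (10) of [4] on level `k`). [cite: Balaban1985UV3, (2) p.256] -/
noncomputable def rho : (k : ℕ) → Balaban1983to89.Density S.P k G
  | 0 => R.rho0
  | k + 1 => (R.T k).T (rho k)

/-- **(4)** p. 256 = PDF 2 L24–27: «The function χ(U) is a characteristic function of the domain  |U(∂p) − 1| < ε₁,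
p ⊂ T₁^{(K)},  (4)»; in (5) the same function of `U` on `T₁^{(k)}` (L35–36 «the configuration U on T₁^{(k)}, and satisfying
(4)»).  `Setup.chiSmall Set.univ`: all positively oriented plaquettes of the level-`k` torus. [cite: Balaban1985UV3, (4) p.256] -/
noncomputable def chi (k : ℕ) : Balaban1983to89.Density S.P k G :=
  Balaban1983to89.chiSmall Set.univ (R.ε₁ k)

/-- The main term `A^η(U_k(U))` of (5) p. 256 = PDF 2 L32–37 as a function of `U` on `T₁^{(k)}`: `Scales.actionEta k`
at the binder `U_k(U)`. [cite: Balaban1985UV3, (5) p.256] -/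
noncomputable def mainTerm (k : ℕ) (V : Balaban1983to89.GaugeField S.P k G) : ℝ :=
  S.actionEta k (R.Uk k V)

/-- **(6)** p. 257 = PDF 3 L11–14, the partition function: «∫dUρ_k = ∫dUT^kρ₀ = ∫dUρ₀ = Z^ε,  (6)» — `Z^ε = ∫dU ρ₀(U)`
over the product Haar measure of `T_ε` (`Setup.fieldMeasure`; = `exp(−E)·Step.wilsonZ P G g₀` of the 4D cell, not
asserted here). [cite: Balaban1985UV3, (6) p.257] -/
noncomputable def Zeps : ℝ :=
  ∫ U, R.rho0 U ∂(Balaban1983to89.fieldMeasure S.P 0 G)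

/-- THE BRIDGE to the 4D cell's abstract carrier: this lattice approximation as a `B10.RunData` — `K`, configurations
`U` on `T₁^{(k)}` = `GaugeField S.P k G`, `ρ_k` = (2), `χ` = (4), `A^η(U_k(U))` = `mainTerm`,
`g_k` = `Scales.gk` (= `B10.gRun`), `|T₁^{(k)}|` = `Scales.sites` (= `B10.sitesRun`), and the (41)/(47) slot.  Through it `B10.Bounds5`, `B10.Bounds5At`, `B10.Thm1Printed`,
`B10.Thm1PrintedCompact` speak about the concrete objects (unfolding lemma `bounds5At_toRunData_iff`). [cite: Balaban1985UV3, (1)–(5) p.256] -/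
noncomputable def toRunData : Balaban1983to89.B10.RunData where
  K := S.K
  Cfg := fun k => Balaban1983to89.GaugeField S.P k G
  ρ := R.rho
  χ := R.chi
  wilsonBG := R.mainTerm
  sites := S.sites
  g := S.gk
  Ineq41_47 := R.ineq41_47

/-- `B10.Bounds5At` on `toRunData`, UNFOLDED — this is display **(5)** p. 256 = PDF 2 L31–34 over the concrete objects:
«χ(U) exp[−(1/g_k²) A^η(U_k(U)) − O(1)|T₁^{(k)}|] ≤ ρ_k(U) ≤ exp O(1)|T₁^{(k)}|,  (5)» with `O(1) = O1`.  Definitional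
(`Iff.rfl`); recorded so the referee can countersign (5) token by token on THIS file. [cite: Balaban1985UV3, (5) p.256] -/
theorem bounds5At_toRunData_iff (O1 : ℝ) (k : ℕ) :
    Balaban1983to89.B10.Bounds5At R.toRunData O1 k ↔
      ∀ U : Balaban1983to89.GaugeField S.P k G,
        R.chi k U * Real.exp (-((S.gk k)⁻¹ ^ 2 * R.mainTerm k U) - O1 * S.sites k) ≤ R.rho k U ∧
          R.rho k U ≤ Real.exp (O1 * S.sites k) :=
  Iff.rfl

/-- **(3)** p. 256 = PDF 2 L19–24: «The ultraviolet stability means that the actions ρ_K have bounds independent of the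
lattice spacing ε. In our case field configurations have values in the compact Lie group G, hence bounds are in uniform
norms, and can be written in a simplest way as  χ(U)e^{−O(1)|T_ε|} ≤ ρ_K(U) ≤ e^{O(1)|T_ε|},  |T_ε| = Σ_{x∈T_ε} ε³,  (3)»
with `O(1) = O1`, `χ` = (4) on `T₁^{(K)}`.  (The passage (5)_K ⇒ (3) is the 4D cell's `…B10Ineq3Terminal`.) [cite: Balaban1985UV3, (3) p.256] -/
def Bounds3 (O1 : ℝ) : Prop :=
  ∀ U : Balaban1983to89.GaugeField S.P S.K G,
    R.chi S.K U * Real.exp (-(O1 * S.volT)) ≤ R.rho S.K U ∧ R.rho S.K U ≤ Real.exp (O1 * S.volT)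

/-- **(6)** p. 257 = PDF 3 L11–14 as a proposition about this run: «The bounds (5) imply bounds for partition functions,
i.e. for the integrals ∫dUρ_k(U), hence by normalization identities  ∫dUρ_k = ∫dUT^kρ₀ = ∫dUρ₀ = Z^ε,  (6)  they imply
uniform in ε bounds for the partition function Z^ε.»  Typed: the identity (6) for every `k ≤ K` (for the tree's `T` it
follows from `Setup.IsRT` tested against `f ≡ 1`, `Step.integral_RT_eq`; the two halves of the Z-bounds are the 4D cell's
`Step.DensityRG.partitionFn_le_exp` / `…B10Eq6DensityLevel.partitionFn_ge`; nothing proved here). [cite: Balaban1985UV3, (6) p.257] -/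
def Eq6 (R : RunObjects S G) : Prop :=
  ∀ k, k ≤ S.K → ∫ V, R.rho k V ∂(Balaban1983to89.fieldMeasure S.P k G) = R.Zeps

/-- WHAT «the minimal configuration constructed in [7]» MEANS for the binders `reg`, `Uk` (p. 256 = PDF 2 L35–36 «U_k(U) is
the minimal configuration constructed in [7] and determined by the configuration U on T₁^{(k)}, and satisfying (4)»;
[7] = [Balaban1985Variational] p. 278 (3) «Ū^j = V on Λ_j», (5) «A(U) = A^η(U) = Σ_{p⊂Ω₀} η^{d−4}[1 − Re tr U(∂p)],
η = L^{−k}», p. 278 «we will prove that there exists a minimal orbit. Elements of the minimal orbit are called minimal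
configurations», Thm 1 p. 279): for every `U` on `T₁^{(k)}` in the domain (4), `U_k(U)` lies in `reg k`, its k-fold
average is `U`, and it minimises the Wilson action among such configurations — `Setup.IsBackground` BY NAME (whose action
`wilsonAction4` has the same minimisers as `A^η = η^{−1}·wilsonAction4`).  A HYPOTHESIS on the binders (discharged for the
printed construction from [7] Thm 1, binder b11 of the lane), not a claim. [cite: Balaban1985Variational, Thm 1 p.279] -/
def IsMinimalConfig (R : RunObjects S G) : Prop :=
  ∀ (k : ℕ) (V : Balaban1983to89.GaugeField S.P k G),
    Balaban1983to89.PlaqSmall (R.ε₁ k) V → Balaban1983to89.IsBackground R.av (R.reg k) k V (R.Uk k V)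

end RunObjects

end Literature.MathematicalPhysics.QuantumFieldTheory.Balaban1985CMP102.Setting
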